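import Mathlib
import HarnessLib
import Summits.Ventures.LatticeQCDFlow.Exactness.IMHDelayedRejectionExact

/-!
# LatticeQCDFlow / Exactness — DELAYED REJECTION WITH THE FLOW FIRST AND ANY SECOND-STAGE PROPOSAL DENSITY IS EXACT ON A GENERAL
# STATE SPACE: a local move, an antithetic re-draw, or a second flow after a rejected flow draw, priced by Tierney–Mira

HONEST FRAMING: exact (Metropolis-corrected) sampling algorithms for lattice gauge theory;
figures of merit are autocorrelation/cost numbers at stated couplings and volumes; no
continuum-physics claim.

Venture `LatticeQCDFlow` (cell pub-lqcd), topic `Exactness`, FANOUT row 30 (lean-1 GEN-43, theme SECOND CHANCES; generalises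
`IMHDelayedRejectionExact`, which is the case `ℓ ≡ 1`).  NEW WORK of the cell over `IMHKernel` and `FlowSamplerFluxSymmetricAcceptance`
(`fluxSymmetric_isReversible`); no definition is introduced, nothing is cited as a fact.  Printed counterparts, NAMED ONLY: Tierney–Mira
1999 §4 and Green–Mira 2001 §2 (the general two-stage rule: second-stage proposal `q₂(x, y₁, ·)` may depend on the current state AND
on the rejected first draw); the tree's finite version `Literature.Probability.MarkovChains.DelayedRejection` ∕
`Scoring.FlowProposalComposites` ("flow first, anything second"; "NOT CLAIMED: general state spaces").

## Setting (general measurable `Ω`; flow law `q`; weight `w > 0` measurable; `π = w·q`; `a = min(1, w(y)/w(x))`)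

Second-stage proposal: a DENSITY `ℓ(x, y₁, ·) ≥ 0` against the flow law `q` (jointly measurable, `∫ ℓ(x, y₁, z) q(dz) ≤ 1` —
sub-stochastic allowed: the missing mass stays put), which may depend on the current configuration `x` (a LOCAL move: `ℓ(x, y₁, ·)`
concentrated near `x`), on the rejected draw `y₁` (an ANTITHETIC or "repaired" re-draw), or on neither (a SECOND FLOW `q₂ = g·q`).
One update from `x`: draw `y₁ ∼ q`, accept with `a(x, y₁)`; if rejected draw `z ∼ ℓ(x, y₁, ·)q` and accept with the Tierney–Mira
probability `min(1, w(z)(1 − a(z, y₁))ℓ(z, y₁, x) / (w(x)(1 − a(x, y₁))ℓ(x, y₁, z)))`; else stay.  Def-free bookkeeping through the product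
`d(x, y₁, z) = min((1 − a(x, y₁))ℓ(x, y₁, z), w(z)(1 − a(z, y₁))ℓ(z, y₁, x)/w(x))` and ANY kernel `K` with
`K(x, B) = ∫_B a dq + ∫ (∫_B d(x, y₁, z) q(dz)) q(dy₁) + (1 − m(x))·1_B(x)`, `m(x) = A(x) + ∫∫ d` (hypothesis `hK`).

## Results [all ours]

* `mul_drSecondL` ∕ `drSecondL_flux_symm`: `w(x)·d(x, y₁, z) = min(w(x)(1 − a(x, y₁))ℓ(x, y₁, z), w(z)(1 − a(z, y₁))ℓ(z, y₁, x))` — symmetric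
  under `x ↔ z` with the rejected draw held fixed.
* `drSecondL_eq_mul`: the algorithmic reading (rejection probability × proposal density × Tierney–Mira acceptance).
* `drSecondL_le`: `d ≤ (1 − a(x, y₁))·ℓ(x, y₁, z)`; `drMassL_le_one`: `m(x) ≤ 1`.
* `drDensityL_flux_symm`, `drL_apply_eq_density`: the landing density `ã(x, z) = a(x, z) + ∫ d(x, y₁, z) q(dy₁)` is flux-symmetric and
  `K` is the accept/reject kernel with density `ã` (Tonelli).
* **`delayedRejectionL_isReversible` ∕ `delayedRejectionL_invariant`**: EVERY such `K` is `π`-reversible and leaves `π = w·q` invariant —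
  for every flow, every positive measurable weight and EVERY admissible second-stage density `ℓ`.
* `drL_apply_ge_indepMH`: off the current state `K ≥ indepMH q w` (the second stage only adds moves).
* `delayedRejection_secondFlow_invariant`: the instance `ℓ(x, y₁, z) = g(z)` — after a rejected draw from the flow `q`, a draw from a
  SECOND flow `g·q` accepted with `min(1, w(z)(1 − a(z, y₁))g(x) / (w(x)(1 − a(x, y₁))g(z)))` is exact.
-/

namespace Summit.Ventures.LatticeQCDFlow.Exactness

open MeasureTheory ProbabilityTheory
open scoped ENNReal

variable {Ω : Type*} [MeasurableSpace Ω] {q : Measure Ω} [IsProbabilityMeasure q] {w : Ω → ℝ} {ℓ : Ω → Ω → Ω → ℝ}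

/-! ## §0 Algebra of the second-stage product density -/

omit [MeasurableSpace Ω] in
/-- `d(x, y₁, z) ≥ 0`. [ours, bookkeeping] -/
theorem drSecondL_nonneg (hw0 : ∀ x, 0 < w x) (hℓ0 : ∀ x y z, 0 ≤ ℓ x y z) (x y₁ z : Ω) :
    0 ≤ min ((1 - imhAccept w x y₁) * ℓ x y₁ z) (w z * (1 - imhAccept w z y₁) * ℓ z y₁ x / w x) :=
  le_min (mul_nonneg (one_sub_imhAccept_nonneg w x y₁) (hℓ0 x y₁ z))
    (div_nonneg (mul_nonneg (mul_nonneg (hw0 z).le (one_sub_imhAccept_nonneg w z y₁)) (hℓ0 z y₁ x)) (hw0 x).le)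

omit [MeasurableSpace Ω] in
/-- `d(x, y₁, z) ≤ (1 − a(x, y₁))·ℓ(x, y₁, z)`: the second stage is entered through a rejection and proposes with density `ℓ`. [ours] -/
theorem drSecondL_le_real (x y₁ z : Ω) :
    min ((1 - imhAccept w x y₁) * ℓ x y₁ z) (w z * (1 - imhAccept w z y₁) * ℓ z y₁ x / w x) ≤ (1 - imhAccept w x y₁) * ℓ x y₁ z :=
  min_le_left _ _

omit [MeasurableSpace Ω] in
/-- **THE SECOND-STAGE FLUX**: `w(x)·d(x, y₁, z) = min(w(x)(1 − a(x, y₁))ℓ(x, y₁, z), w(z)(1 − a(z, y₁))ℓ(z, y₁, x))`. [ours] -/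
theorem mul_drSecondL (hw0 : ∀ x, 0 < w x) (x y₁ z : Ω) :
    w x * min ((1 - imhAccept w x y₁) * ℓ x y₁ z) (w z * (1 - imhAccept w z y₁) * ℓ z y₁ x / w x) =
      min (w x * (1 - imhAccept w x y₁) * ℓ x y₁ z) (w z * (1 - imhAccept w z y₁) * ℓ z y₁ x) := by
  rw [mul_min_of_nonneg _ _ (hw0 x).le, mul_div_assoc', mul_div_cancel_left₀ _ (hw0 x).ne']
  simp only [mul_assoc]

omit [MeasurableSpace Ω] in
/-- **… SYMMETRIC UNDER `x ↔ z`** (the rejected draw `y₁` held fixed). [ours] -/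
theorem mul_drSecondL_symm (hw0 : ∀ x, 0 < w x) (x y₁ z : Ω) :
    w x * min ((1 - imhAccept w x y₁) * ℓ x y₁ z) (w z * (1 - imhAccept w z y₁) * ℓ z y₁ x / w x) =
      w z * min ((1 - imhAccept w z y₁) * ℓ z y₁ x) (w x * (1 - imhAccept w x y₁) * ℓ x y₁ z / w z) := by
  rw [mul_drSecondL hw0, mul_drSecondL hw0, min_comm]

omit [MeasurableSpace Ω] in
/-- **THE ALGORITHMIC READING**: where the second stage can propose `z` after rejecting `y₁` (`(1 − a(x, y₁))·ℓ(x, y₁, z) > 0`),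
`d = (1 − a(x, y₁))·ℓ(x, y₁, z)·min(1, w(z)(1 − a(z, y₁))ℓ(z, y₁, x) / (w(x)(1 − a(x, y₁))ℓ(x, y₁, z)))` — rejection probability × proposal
density × Tierney–Mira acceptance. [ours] -/
theorem drSecondL_eq_mul {x y₁ z : Ω} (h : 0 < (1 - imhAccept w x y₁) * ℓ x y₁ z) :
    min ((1 - imhAccept w x y₁) * ℓ x y₁ z) (w z * (1 - imhAccept w z y₁) * ℓ z y₁ x / w x) =
      (1 - imhAccept w x y₁) * ℓ x y₁ z *
        min 1 (w z * (1 - imhAccept w z y₁) * ℓ z y₁ x / (w x * ((1 - imhAccept w x y₁) * ℓ x y₁ z))) := by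
  rw [mul_min_of_nonneg _ _ h.le, mul_one]
  congr 1
  rw [mul_div_assoc', mul_comm (w x) ((1 - imhAccept w x y₁) * ℓ x y₁ z), mul_div_mul_left _ _ h.ne']

/-! ## §1 `ℝ≥0∞` densities: measurability, flux symmetry, the ceiling -/

omit [MeasurableSpace Ω] in
/-- Flux symmetry of the second stage in `ℝ≥0∞`. [ours] -/
theorem drSecondL_flux_symm (hw0 : ∀ x, 0 < w x) (x y₁ z : Ω) :
    ENNReal.ofReal (w x) * ENNReal.ofReal (min ((1 - imhAccept w x y₁) * ℓ x y₁ z) (w z * (1 - imhAccept w z y₁) * ℓ z y₁ x / w x)) =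
      ENNReal.ofReal (w z) *
        ENNReal.ofReal (min ((1 - imhAccept w z y₁) * ℓ z y₁ x) (w x * (1 - imhAccept w x y₁) * ℓ x y₁ z / w z)) := by
  rw [← ENNReal.ofReal_mul (hw0 x).le, ← ENNReal.ofReal_mul (hw0 z).le, mul_drSecondL_symm hw0]

omit [MeasurableSpace Ω] in
/-- `ofReal d(x, y₁, z) ≤ (1 − imhAcceptE w x y₁)·ofReal ℓ(x, y₁, z)`. [ours] -/
theorem drSecondL_le (hw0 : ∀ x, 0 < w x) (x y₁ z : Ω) :
    ENNReal.ofReal (min ((1 - imhAccept w x y₁) * ℓ x y₁ z) (w z * (1 - imhAccept w z y₁) * ℓ z y₁ x / w x)) ≤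
      (1 - imhAcceptE w x y₁) * ENNReal.ofReal (ℓ x y₁ z) := by
  rw [imhAcceptE, ← ENNReal.ofReal_one, ← ENNReal.ofReal_sub _ (imhAccept_nonneg hw0 x y₁),
    ← ENNReal.ofReal_mul (one_sub_imhAccept_nonneg w x y₁)]
  exact ENNReal.ofReal_le_ofReal (drSecondL_le_real x y₁ z)

/-- Measurability of the second-stage product density along any measurable parametrisation `t ↦ (X t, Y t, Z t)` of
(current state, rejected draw, second draw) — stated this way so that every instance below is a cheap specialisation. [ours, bookkeeping] -/
theorem measurable_drSecondL_comp {α : Type*} [MeasurableSpace α] {X Y Z : α → Ω} (hw : Measurable w)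
    (hX : Measurable X) (hY : Measurable Y) (hZ : Measurable Z)
    (hℓ₁ : Measurable fun t => ℓ (X t) (Y t) (Z t)) (hℓ₂ : Measurable fun t => ℓ (Z t) (Y t) (X t)) :
    Measurable fun t => ENNReal.ofReal (min ((1 - imhAccept w (X t) (Y t)) * ℓ (X t) (Y t) (Z t))
      (w (Z t) * (1 - imhAccept w (Z t) (Y t)) * ℓ (Z t) (Y t) (X t) / w (X t))) := by
  unfold imhAccept
  have h1 : Measurable fun t => w (X t) := hw.comp hX
  have h2 : Measurable fun t => w (Y t) := hw.comp hY
  have h3 : Measurable fun t => w (Z t) := hw.comp hZ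
  exact (((measurable_const.sub (measurable_const.min (h2.div h1))).mul hℓ₁).min
    (((h3.mul (measurable_const.sub (measurable_const.min (h2.div h3)))).mul hℓ₂).div h1)).ennreal_ofReal

/-- Joint measurability of `d` on `Ω × Ω × Ω` (as `(x, y₁, z)`). [ours, bookkeeping] -/
theorem measurable_drSecondL (hw : Measurable w) (hℓ : Measurable fun p : Ω × Ω × Ω => ℓ p.1 p.2.1 p.2.2) :
    Measurable fun p : Ω × Ω × Ω =>
      ENNReal.ofReal (min ((1 - imhAccept w p.1 p.2.1) * ℓ p.1 p.2.1 p.2.2)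
        (w p.2.2 * (1 - imhAccept w p.2.2 p.2.1) * ℓ p.2.2 p.2.1 p.1 / w p.1)) :=
  measurable_drSecondL_comp hw measurable_fst (measurable_fst.comp measurable_snd) (measurable_snd.comp measurable_snd) hℓ
    (hℓ.comp ((measurable_snd.comp measurable_snd).prodMk ((measurable_fst.comp measurable_snd).prodMk measurable_fst)))

/-- Measurability of `d(x, ·, z)` in the rejected draw. [ours, bookkeeping] -/
theorem measurable_drSecondL_mid (hw : Measurable w) (hℓ : Measurable fun p : Ω × Ω × Ω => ℓ p.1 p.2.1 p.2.2) (x z : Ω) :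
    Measurable fun y₁ =>
      ENNReal.ofReal (min ((1 - imhAccept w x y₁) * ℓ x y₁ z) (w z * (1 - imhAccept w z y₁) * ℓ z y₁ x / w x)) :=
  measurable_drSecondL_comp hw measurable_const measurable_id measurable_const
    (hℓ.comp (measurable_const.prodMk (measurable_id.prodMk measurable_const)))
    (hℓ.comp (measurable_const.prodMk (measurable_id.prodMk measurable_const)))

/-- Measurability of `d(x, ·, ·)` in (rejected draw, second draw). [ours, bookkeeping] -/
theorem measurable_drSecondL_left (hw : Measurable w) (hℓ : Measurable fun p : Ω × Ω × Ω => ℓ p.1 p.2.1 p.2.2) (x : Ω) :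
    Measurable (Function.uncurry fun y₁ z : Ω =>
      ENNReal.ofReal (min ((1 - imhAccept w x y₁) * ℓ x y₁ z) (w z * (1 - imhAccept w z y₁) * ℓ z y₁ x / w x))) :=
  measurable_drSecondL_comp hw measurable_const measurable_fst measurable_snd
    (hℓ.comp (measurable_const.prodMk (measurable_fst.prodMk measurable_snd)))
    (hℓ.comp (measurable_snd.prodMk (measurable_fst.prodMk measurable_const)))

variable (q) in
/-- Measurability of the marginal second-stage density `(x, z) ↦ ∫ d(x, y₁, z) q(dy₁)`. [ours, bookkeeping] -/
theorem measurable_lintegral_drSecondL (hw : Measurable w) (hℓ : Measurable fun p : Ω × Ω × Ω => ℓ p.1 p.2.1 p.2.2) :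
    Measurable (Function.uncurry fun x z : Ω =>
      ∫⁻ y₁, ENNReal.ofReal (min ((1 - imhAccept w x y₁) * ℓ x y₁ z) (w z * (1 - imhAccept w z y₁) * ℓ z y₁ x / w x)) ∂q) := by
  have hf : Measurable fun r : (Ω × Ω) × Ω =>
      ENNReal.ofReal (min ((1 - imhAccept w r.1.1 r.2) * ℓ r.1.1 r.2 r.1.2)
        (w r.1.2 * (1 - imhAccept w r.1.2 r.2) * ℓ r.1.2 r.2 r.1.1 / w r.1.1)) :=
    measurable_drSecondL_comp hw (measurable_fst.comp measurable_fst) measurable_snd (measurable_snd.comp measurable_fst)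
      (hℓ.comp ((measurable_fst.comp measurable_fst).prodMk (measurable_snd.prodMk (measurable_snd.comp measurable_fst))))
      (hℓ.comp ((measurable_snd.comp measurable_fst).prodMk (measurable_snd.prodMk (measurable_fst.comp measurable_fst))))
  exact hf.lintegral_prod_right'

variable (q) in
/-- Measurability of the total landing density `ã(x, z) = a(x, z) + ∫ d(x, y₁, z) q(dy₁)`. [ours, bookkeeping] -/
theorem measurable_drDensityL (hw : Measurable w) (hℓ : Measurable fun p : Ω × Ω × Ω => ℓ p.1 p.2.1 p.2.2) :
    Measurable (Function.uncurry fun x z : Ω => imhAcceptE w x z +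
      ∫⁻ y₁, ENNReal.ofReal (min ((1 - imhAccept w x y₁) * ℓ x y₁ z) (w z * (1 - imhAccept w z y₁) * ℓ z y₁ x / w x)) ∂q) :=
  (measurable_imhAcceptE hw).add (measurable_lintegral_drSecondL q hw hℓ)

omit [IsProbabilityMeasure q] in
/-- **THE LANDING DENSITY IS FLUX-SYMMETRIC**: `w(x)·ã(x, z) = w(z)·ã(z, x)`. [ours] -/
theorem drDensityL_flux_symm (hw : Measurable w) (hw0 : ∀ x, 0 < w x) (hℓ : Measurable fun p : Ω × Ω × Ω => ℓ p.1 p.2.1 p.2.2)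
    (x z : Ω) :
    ENNReal.ofReal (w x) * (imhAcceptE w x z +
        ∫⁻ y₁, ENNReal.ofReal (min ((1 - imhAccept w x y₁) * ℓ x y₁ z) (w z * (1 - imhAccept w z y₁) * ℓ z y₁ x / w x)) ∂q) =
      ENNReal.ofReal (w z) * (imhAcceptE w z x +
        ∫⁻ y₁, ENNReal.ofReal (min ((1 - imhAccept w z y₁) * ℓ z y₁ x) (w x * (1 - imhAccept w x y₁) * ℓ x y₁ z / w z)) ∂q) := by
  rw [mul_add, mul_add, ofReal_mul_imhAcceptE hw0, ofReal_mul_imhAcceptE hw0, min_comm,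
    ← lintegral_const_mul _ (measurable_drSecondL_mid hw hℓ x z), ← lintegral_const_mul _ (measurable_drSecondL_mid hw hℓ z x)]
  congr 1
  exact lintegral_congr fun y₁ => drSecondL_flux_symm hw0 x y₁ z

/-! ## §2 The two-stage set formula is an accept/reject kernel with density `ã` -/

omit [IsProbabilityMeasure q] in
/-- Tonelli for the second stage (restricted). [ours, bookkeeping] -/
theorem lintegral_setLIntegral_drSecondL_swap [SFinite q] (hw : Measurable w)
    (hℓ : Measurable fun p : Ω × Ω × Ω => ℓ p.1 p.2.1 p.2.2) (x : Ω) (B : Set Ω) :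
    ∫⁻ y₁, ∫⁻ z in B, ENNReal.ofReal (min ((1 - imhAccept w x y₁) * ℓ x y₁ z) (w z * (1 - imhAccept w z y₁) * ℓ z y₁ x / w x)) ∂q ∂q =
      ∫⁻ z in B, ∫⁻ y₁, ENNReal.ofReal (min ((1 - imhAccept w x y₁) * ℓ x y₁ z) (w z * (1 - imhAccept w z y₁) * ℓ z y₁ x / w x)) ∂q ∂q := by
  exact lintegral_lintegral_swap ((measurable_drSecondL_left hw hℓ x).aemeasurable (μ := q.prod (q.restrict B)))

omit [IsProbabilityMeasure q] in
/-- Tonelli for the second-stage mass. [ours, bookkeeping] -/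
theorem lintegral_lintegral_drSecondL_swap [SFinite q] (hw : Measurable w)
    (hℓ : Measurable fun p : Ω × Ω × Ω => ℓ p.1 p.2.1 p.2.2) (x : Ω) :
    ∫⁻ y₁, ∫⁻ z, ENNReal.ofReal (min ((1 - imhAccept w x y₁) * ℓ x y₁ z) (w z * (1 - imhAccept w z y₁) * ℓ z y₁ x / w x)) ∂q ∂q =
      ∫⁻ z, ∫⁻ y₁, ENNReal.ofReal (min ((1 - imhAccept w x y₁) * ℓ x y₁ z) (w z * (1 - imhAccept w z y₁) * ℓ z y₁ x / w x)) ∂q ∂q := by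
  exact lintegral_lintegral_swap ((measurable_drSecondL_left hw hℓ x).aemeasurable (μ := q.prod q))

/-- **THE TWO-STAGE FORMULA AS A ONE-DENSITY KERNEL.** [ours] -/
theorem drL_apply_eq_density (hw : Measurable w) (hℓ : Measurable fun p : Ω × Ω × Ω => ℓ p.1 p.2.1 p.2.2) (K : Kernel Ω Ω)
    (hK : ∀ (x : Ω) {B : Set Ω}, MeasurableSet B → K x B =
      ∫⁻ z in B, imhAcceptE w x z ∂q +
        ∫⁻ y₁, ∫⁻ z in B, ENNReal.ofReal (min ((1 - imhAccept w x y₁) * ℓ x y₁ z)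
          (w z * (1 - imhAccept w z y₁) * ℓ z y₁ x / w x)) ∂q ∂q +
        (1 - (imhAcceptMass q w x + ∫⁻ y₁, ∫⁻ z, ENNReal.ofReal (min ((1 - imhAccept w x y₁) * ℓ x y₁ z)
          (w z * (1 - imhAccept w z y₁) * ℓ z y₁ x / w x)) ∂q ∂q)) * B.indicator 1 x)
    (x : Ω) {B : Set Ω} (hB : MeasurableSet B) :
    K x B = ∫⁻ z in B, (imhAcceptE w x z +
        ∫⁻ y₁, ENNReal.ofReal (min ((1 - imhAccept w x y₁) * ℓ x y₁ z) (w z * (1 - imhAccept w z y₁) * ℓ z y₁ x / w x)) ∂q) ∂q +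
      (1 - ∫⁻ z, (imhAcceptE w x z +
        ∫⁻ y₁, ENNReal.ofReal (min ((1 - imhAccept w x y₁) * ℓ x y₁ z) (w z * (1 - imhAccept w z y₁) * ℓ z y₁ x / w x)) ∂q) ∂q) *
        B.indicator 1 x := by
  have ha : Measurable fun z => imhAcceptE w x z := (measurable_imhAcceptE hw).of_uncurry_left
  rw [hK x hB, lintegral_add_left ha, lintegral_add_left ha, lintegral_setLIntegral_drSecondL_swap hw hℓ x B,
    lintegral_lintegral_drSecondL_swap hw hℓ x]
  simp only [imhAcceptMass]

/-! ## §3 Exactness -/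

/-- **DELAYED REJECTION WITH THE FLOW FIRST AND ANY SECOND-STAGE PROPOSAL DENSITY IS EXACT — DETAILED BALANCE.**  For every flow law `q`,
positive measurable weight `w`, jointly measurable second-stage density `ℓ`, and ANY kernel `K` realising the two-stage rule, `K` is reversible
with respect to `π = w·q`. [ours] -/
theorem delayedRejectionL_isReversible (hw : Measurable w) (hw0 : ∀ x, 0 < w x)
    (hℓ : Measurable fun p : Ω × Ω × Ω => ℓ p.1 p.2.1 p.2.2) (K : Kernel Ω Ω)
    (hK : ∀ (x : Ω) {B : Set Ω}, MeasurableSet B → K x B =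
      ∫⁻ z in B, imhAcceptE w x z ∂q +
        ∫⁻ y₁, ∫⁻ z in B, ENNReal.ofReal (min ((1 - imhAccept w x y₁) * ℓ x y₁ z)
          (w z * (1 - imhAccept w z y₁) * ℓ z y₁ x / w x)) ∂q ∂q +
        (1 - (imhAcceptMass q w x + ∫⁻ y₁, ∫⁻ z, ENNReal.ofReal (min ((1 - imhAccept w x y₁) * ℓ x y₁ z)
          (w z * (1 - imhAccept w z y₁) * ℓ z y₁ x / w x)) ∂q ∂q)) * B.indicator 1 x) :
    Kernel.IsReversible K (q.withDensity fun x => ENNReal.ofReal (w x)) :=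
  fluxSymmetric_isReversible hw (measurable_drDensityL q hw hℓ) (drDensityL_flux_symm hw hw0 hℓ) K
    (fun x _ hB => drL_apply_eq_density hw hℓ K hK x hB)

/-- **… INVARIANCE**: `π = w·q` is invariant under every such kernel. [ours] -/
theorem delayedRejectionL_invariant (hw : Measurable w) (hw0 : ∀ x, 0 < w x)
    (hℓ : Measurable fun p : Ω × Ω × Ω => ℓ p.1 p.2.1 p.2.2) (K : Kernel Ω Ω) [IsMarkovKernel K]
    (hK : ∀ (x : Ω) {B : Set Ω}, MeasurableSet B → K x B =
      ∫⁻ z in B, imhAcceptE w x z ∂q +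
        ∫⁻ y₁, ∫⁻ z in B, ENNReal.ofReal (min ((1 - imhAccept w x y₁) * ℓ x y₁ z)
          (w z * (1 - imhAccept w z y₁) * ℓ z y₁ x / w x)) ∂q ∂q +
        (1 - (imhAcceptMass q w x + ∫⁻ y₁, ∫⁻ z, ENNReal.ofReal (min ((1 - imhAccept w x y₁) * ℓ x y₁ z)
          (w z * (1 - imhAccept w z y₁) * ℓ z y₁ x / w x)) ∂q ∂q)) * B.indicator 1 x) :
    Kernel.Invariant K (q.withDensity fun x => ENNReal.ofReal (w x)) :=
  (delayedRejectionL_isReversible hw hw0 hℓ K hK).invariant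

/-! ## §4 Mass and domination -/

/-- **THE MOVE MASS IS AT MOST ONE** when the second-stage density is sub-stochastic (`∫ ℓ(x, y₁, z) q(dz) ≤ 1`). [ours] -/
theorem drMassL_le_one (hw : Measurable w) (hw0 : ∀ x, 0 < w x) (hℓ : Measurable fun p : Ω × Ω × Ω => ℓ p.1 p.2.1 p.2.2)
    (hℓ1 : ∀ x y₁, ∫⁻ z, ENNReal.ofReal (ℓ x y₁ z) ∂q ≤ 1) (x : Ω) :
    imhAcceptMass q w x + ∫⁻ y₁, ∫⁻ z, ENNReal.ofReal (min ((1 - imhAccept w x y₁) * ℓ x y₁ z)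
      (w z * (1 - imhAccept w z y₁) * ℓ z y₁ x / w x)) ∂q ∂q ≤ 1 := by
  have ha : Measurable fun y => imhAcceptE w x y := (measurable_imhAcceptE hw).of_uncurry_left
  have hℓx : ∀ y₁, Measurable fun z => ENNReal.ofReal (ℓ x y₁ z) := fun y₁ =>
    (hℓ.comp (measurable_const.prodMk (measurable_const.prodMk measurable_id))).ennreal_ofReal
  calc imhAcceptMass q w x + ∫⁻ y₁, ∫⁻ z, ENNReal.ofReal (min ((1 - imhAccept w x y₁) * ℓ x y₁ z)
        (w z * (1 - imhAccept w z y₁) * ℓ z y₁ x / w x)) ∂q ∂q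
      ≤ imhAcceptMass q w x + ∫⁻ y₁, ∫⁻ z, (1 - imhAcceptE w x y₁) * ENNReal.ofReal (ℓ x y₁ z) ∂q ∂q := by
        gcongr with y₁ z
        exact drSecondL_le hw0 x y₁ z
    _ ≤ imhAcceptMass q w x + ∫⁻ y₁, (1 - imhAcceptE w x y₁) ∂q := by
        gcongr with y₁
        rw [lintegral_const_mul _ (hℓx y₁)]
        exact mul_le_of_le_one_right' (hℓ1 x y₁)
    _ = ∫⁻ y₁, (imhAcceptE w x y₁ + (1 - imhAcceptE w x y₁)) ∂q := by
        rw [lintegral_add_left ha]; rfl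
    _ = ∫⁻ _y₁, 1 ∂q := lintegral_congr fun y₁ => add_tsub_cancel_of_le (imhAcceptE_le_one w x y₁)
    _ = 1 := by rw [lintegral_const, measure_univ, mul_one]

/-- Hence `K(x, Ω) = 1`: the kernel is Markov. [ours] -/
theorem drL_apply_univ (hw : Measurable w) (hw0 : ∀ x, 0 < w x) (hℓ : Measurable fun p : Ω × Ω × Ω => ℓ p.1 p.2.1 p.2.2)
    (hℓ1 : ∀ x y₁, ∫⁻ z, ENNReal.ofReal (ℓ x y₁ z) ∂q ≤ 1) (K : Kernel Ω Ω)
    (hK : ∀ (x : Ω) {B : Set Ω}, MeasurableSet B → K x B =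
      ∫⁻ z in B, imhAcceptE w x z ∂q +
        ∫⁻ y₁, ∫⁻ z in B, ENNReal.ofReal (min ((1 - imhAccept w x y₁) * ℓ x y₁ z)
          (w z * (1 - imhAccept w z y₁) * ℓ z y₁ x / w x)) ∂q ∂q +
        (1 - (imhAcceptMass q w x + ∫⁻ y₁, ∫⁻ z, ENNReal.ofReal (min ((1 - imhAccept w x y₁) * ℓ x y₁ z)
          (w z * (1 - imhAccept w z y₁) * ℓ z y₁ x / w x)) ∂q ∂q)) * B.indicator 1 x)
    (x : Ω) : K x Set.univ = 1 := by
  rw [hK x MeasurableSet.univ]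
  simp only [Measure.restrict_univ, Set.indicator_univ, Pi.one_apply, mul_one]
  rw [show ∫⁻ y, imhAcceptE w x y ∂q = imhAcceptMass q w x from rfl]
  exact add_tsub_cancel_of_le (drMassL_le_one hw hw0 hℓ hℓ1 x)

/-- **DOMINATION OFF THE DIAGONAL**: for `B ∌ x`, `indepMH q w (x, B) ≤ K(x, B)`. [ours] -/
theorem drL_apply_ge_indepMH (hw : Measurable w) (K : Kernel Ω Ω)
    (hK : ∀ (x : Ω) {B : Set Ω}, MeasurableSet B → K x B =
      ∫⁻ z in B, imhAcceptE w x z ∂q +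
        ∫⁻ y₁, ∫⁻ z in B, ENNReal.ofReal (min ((1 - imhAccept w x y₁) * ℓ x y₁ z)
          (w z * (1 - imhAccept w z y₁) * ℓ z y₁ x / w x)) ∂q ∂q +
        (1 - (imhAcceptMass q w x + ∫⁻ y₁, ∫⁻ z, ENNReal.ofReal (min ((1 - imhAccept w x y₁) * ℓ x y₁ z)
          (w z * (1 - imhAccept w z y₁) * ℓ z y₁ x / w x)) ∂q ∂q)) * B.indicator 1 x)
    {x : Ω} {B : Set Ω} (hB : MeasurableSet B) (hx : x ∉ B) : indepMH q w x B ≤ K x B := by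
  rw [indepMH_apply hw x hB, hK x hB, Set.indicator_of_notMem hx, mul_zero, mul_zero, add_zero, add_zero]
  exact le_self_add

/-! ## §5 Instance: the second stage from another flow -/

/-- **A SECOND FLOW AFTER A REJECTED FIRST FLOW IS EXACT**: with `ℓ(x, y₁, z) = g(z)` (a second flow `g·q`, `g ≥ 0` measurable), ANY kernel
realising the two-stage rule with Tierney–Mira acceptance `min(1, w(z)(1 − a(z, y₁))g(x) / (w(x)(1 − a(x, y₁))g(z)))` leaves `π` invariant. [ours] -/
theorem delayedRejection_secondFlow_invariant (hw : Measurable w) (hw0 : ∀ x, 0 < w x) {g : Ω → ℝ} (hg : Measurable g)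
    (K : Kernel Ω Ω) [IsMarkovKernel K]
    (hK : ∀ (x : Ω) {B : Set Ω}, MeasurableSet B → K x B =
      ∫⁻ z in B, imhAcceptE w x z ∂q +
        ∫⁻ y₁, ∫⁻ z in B, ENNReal.ofReal (min ((1 - imhAccept w x y₁) * g z)
          (w z * (1 - imhAccept w z y₁) * g x / w x)) ∂q ∂q +
        (1 - (imhAcceptMass q w x + ∫⁻ y₁, ∫⁻ z, ENNReal.ofReal (min ((1 - imhAccept w x y₁) * g z)
          (w z * (1 - imhAccept w z y₁) * g x / w x)) ∂q ∂q)) * B.indicator 1 x) :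
    Kernel.Invariant K (q.withDensity fun x => ENNReal.ofReal (w x)) :=
  delayedRejectionL_invariant (ℓ := fun _ _ z => g z) hw hw0 (hg.comp (measurable_snd.comp measurable_snd)) K hK

end Summit.Ventures.LatticeQCDFlow.Exactness
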